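import Mathlib.RepresentationTheory.Irreducible
import Mathlib.RepresentationTheory.Semisimple
import Mathlib.RepresentationTheory.Character
import Mathlib.LinearAlgebra.Determinant
import Mathlib.Algebra.Group.Hom.Instances
import HarnessLib

/-!
# Twisting representations by characters

Topic `Literature/RepresentationTheory/Semisimple`.  For a representation `ρ : G → GL(V)` over a
field `k` and a character `χ : G → kˣ` (a `MonoidHom`), the **twist** `ρ ⊗ χ : g ↦ χ(g) ρ(g)` on
the same space (Curtis–Reiner, *Methods of Representation Theory* I, § 10 (tensoring with a
linear character); Serre, *Linear Representations of Finite Groups*, § 3.3 Ex. 3.4).  Mathlib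
(this pin) has `Representation.tprod` (tensor product of two representations) but no name for
the twist by a one-dimensional character on the *same* space, which is what the `ℓ`-adic
applications use (`ρ ⊗ ε_ℓ^n`; e.g. Harris–Lan–Taylor–Thorne's `R ≅ r ⊕ r^{c,∨} ε^{1-2n}`,
`Literature/NumberTheory/GaloisRepresentations/TwistedSumDecomposition`).  Everything here is
elementary and fully proved.

* `Representation.twist ρ χ` and its algebra: `twist_one`, `twist_twist`
  (`(ρ ⊗ χ) ⊗ χ' = ρ ⊗ χχ'`), `twist_twist_inv`, `twist_inv_twist`;
* subrepresentations of `ρ` and of `ρ ⊗ χ` coincide (`Subrepresentation.twist`, `untwist`,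
  `twistOrderIso`), so twisting preserves irreducibility and semisimplicity
  (`Representation.isIrreducible_twist_iff`, `isSemisimpleRepresentation_twist_iff`, and
  instances);
* `G`-maps and equivalences twist (`IntertwiningMap.twist`, `twistLinearEquiv :
  Hom_G(ρ, σ) ≃ₗ[k] Hom_G(ρ ⊗ χ, σ ⊗ χ)`, `Equiv.twist`);
* the character `χ_{ρ ⊗ χ}(g) = χ(g) χ_ρ(g)` (`Representation.character_twist`);
* for groups: if `ρ ≃ ρ ⊗ χ` then `χ(g)^{dim V} = 1` (determinants,
  `pow_finrank_eq_one_of_equiv_twist`), whence **freeness of twisting by powers**: a non-zero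
  finite-dimensional `ρ` with `ρ ≃ ρ ⊗ μⁿ`, where some `μ(g₀)` has infinite order, has `n = 0`
  (`Representation.eq_zero_of_equiv_twist_zpow`).

Declarations live in `namespace Literature.RepresentationTheory.Semisimple`, named after the
Mathlib structures they concern; nothing is added to Mathlib's namespaces.
-/

noncomputable section

namespace Literature.RepresentationTheory.Semisimple

open scoped MonoidAlgebra

universe u v w w'

variable {k : Type u} [Field k] {G : Type v} [Monoid G]
  {V : Type w} [AddCommGroup V] [Module k V] {W : Type w'} [AddCommGroup W] [Module k W]

/-- The **twist** `ρ ⊗ χ` of a representation `ρ` by a character `χ : G → kˣ`: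
`g ↦ χ(g) ρ(g)` on the same space. [folklore] -/
def Representation.twist (ρ : Representation k G V) (χ : G →* kˣ) : Representation k G V where
  toFun g := ((χ g : kˣ) : k) • ρ g
  map_one' := by simp
  map_mul' g h := LinearMap.ext fun v => by
    simp only [map_mul, Units.val_mul, LinearMap.smul_apply, Module.End.mul_apply,
      LinearMap.map_smul, mul_smul]

/-- Unfolding lemma for `Representation.twist`. [folklore] -/
@[simp] theorem Representation.twist_apply (ρ : Representation k G V) (χ : G →* kˣ) (g : G) :
    Representation.twist ρ χ g = ((χ g : kˣ) : k) • ρ g := rfl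

/-- Unfolding lemma for `Representation.twist`, applied to a vector. [folklore] -/
theorem Representation.twist_apply_apply (ρ : Representation k G V) (χ : G →* kˣ) (g : G)
    (v : V) : Representation.twist ρ χ g v = ((χ g : kˣ) : k) • ρ g v := rfl

/-- Twisting by the trivial character does nothing. [folklore] -/
@[simp] theorem Representation.twist_one (ρ : Representation k G V) :
    Representation.twist ρ 1 = ρ := by
  ext g v; simp

/-- Twists compose: `(ρ ⊗ χ) ⊗ χ' = ρ ⊗ χχ'`. [folklore] -/
theorem Representation.twist_twist (ρ : Representation k G V) (χ χ' : G →* kˣ) :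
    Representation.twist (Representation.twist ρ χ) χ' = Representation.twist ρ (χ * χ') := by
  ext g v
  simp only [Representation.twist_apply_apply, MonoidHom.mul_apply, Units.val_mul, mul_smul]
  rw [smul_comm]

/-- `(ρ ⊗ χ) ⊗ χ⁻¹ = ρ`. [folklore] -/
@[simp] theorem Representation.twist_twist_inv (ρ : Representation k G V) (χ : G →* kˣ) :
    Representation.twist (Representation.twist ρ χ) χ⁻¹ = ρ := by
  ext g v
  simp [smul_smul]

/-- `(ρ ⊗ χ⁻¹) ⊗ χ = ρ`. [folklore] -/
@[simp] theorem Representation.twist_inv_twist (ρ : Representation k G V) (χ : G →* kˣ) :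
    Representation.twist (Representation.twist ρ χ⁻¹) χ = ρ := by
  ext g v
  simp [smul_smul]

/-! ### Subrepresentations of a twist -/

/-- A subrepresentation of `ρ` is a subrepresentation of every twist `ρ ⊗ χ` (same underlying
submodule). [folklore] -/
def Subrepresentation.twist {ρ : Representation k G V} (S : Subrepresentation ρ) (χ : G →* kˣ) :
    Subrepresentation (Representation.twist ρ χ) where
  toSubmodule := S.toSubmodule
  apply_mem_toSubmodule g v hv := by
    rw [Representation.twist_apply_apply]
    exact S.toSubmodule.smul_mem _ (S.apply_mem_toSubmodule g hv)

/-- Unfolding lemma for `Subrepresentation.twist`. [folklore] -/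
@[simp] theorem Subrepresentation.toSubmodule_twist {ρ : Representation k G V}
    (S : Subrepresentation ρ) (χ : G →* kˣ) :
    (Subrepresentation.twist S χ).toSubmodule = S.toSubmodule := rfl

/-- Conversely, a subrepresentation of `ρ ⊗ χ` is a subrepresentation of `ρ` (same underlying
submodule; multiply by `χ(g)⁻¹`). [folklore] -/
def Subrepresentation.untwist {ρ : Representation k G V} {χ : G →* kˣ}
    (S : Subrepresentation (Representation.twist ρ χ)) : Subrepresentation ρ where
  toSubmodule := S.toSubmodule
  apply_mem_toSubmodule g v hv := by
    have h := S.toSubmodule.smul_mem (((χ g)⁻¹ : kˣ) : k) (S.apply_mem_toSubmodule g hv)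
    rwa [Representation.twist_apply_apply, smul_smul, Units.inv_mul, one_smul] at h

/-- Unfolding lemma for `Subrepresentation.untwist`. [folklore] -/
@[simp] theorem Subrepresentation.toSubmodule_untwist {ρ : Representation k G V} {χ : G →* kˣ}
    (S : Subrepresentation (Representation.twist ρ χ)) :
    (Subrepresentation.untwist S).toSubmodule = S.toSubmodule := rfl

/-- Subrepresentations of `ρ` and of `ρ ⊗ χ` correspond (order isomorphism). [folklore] -/
def Subrepresentation.twistOrderIso (ρ : Representation k G V) (χ : G →* kˣ) :
    Subrepresentation ρ ≃o Subrepresentation (Representation.twist ρ χ) where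
  toFun S := Subrepresentation.twist S χ
  invFun S := Subrepresentation.untwist S
  left_inv _ := Subrepresentation.toSubmodule_injective rfl
  right_inv _ := Subrepresentation.toSubmodule_injective rfl
  map_rel_iff' := Iff.rfl

/-- Twisting preserves irreducibility. [folklore] -/
theorem Representation.isIrreducible_twist_iff (ρ : Representation k G V) (χ : G →* kˣ) :
    (Representation.twist ρ χ).IsIrreducible ↔ ρ.IsIrreducible :=
  (Subrepresentation.twistOrderIso ρ χ).isSimpleOrder_iff.symm

/-- Twisting preserves semisimplicity. [folklore] -/
theorem Representation.isSemisimpleRepresentation_twist_iff (ρ : Representation k G V)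
    (χ : G →* kˣ) :
    (Representation.twist ρ χ).IsSemisimpleRepresentation ↔ ρ.IsSemisimpleRepresentation :=
  (Subrepresentation.twistOrderIso ρ χ).complementedLattice_iff.symm

/-- The twist of an irreducible representation is irreducible (instance form). [folklore] -/
instance Representation.isIrreducible_twist (ρ : Representation k G V) (χ : G →* kˣ)
    [ρ.IsIrreducible] : (Representation.twist ρ χ).IsIrreducible :=
  (Representation.isIrreducible_twist_iff ρ χ).mpr ‹_›

/-- The twist of a semisimple representation is semisimple (instance form). [folklore] -/
instance Representation.isSemisimpleRepresentation_twist (ρ : Representation k G V) (χ : G →* kˣ)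
    [ρ.IsSemisimpleRepresentation] : (Representation.twist ρ χ).IsSemisimpleRepresentation :=
  (Representation.isSemisimpleRepresentation_twist_iff ρ χ).mpr ‹_›

/-! ### Intertwining maps and equivalences of twists -/

/-- An intertwining map `ρ → σ` intertwines the twists `ρ ⊗ χ → σ ⊗ χ` (same linear map).
[folklore] -/
def Representation.IntertwiningMap.twist {ρ : Representation k G V} {σ : Representation k G W}
    (f : Representation.IntertwiningMap ρ σ) (χ : G →* kˣ) :
    Representation.IntertwiningMap (Representation.twist ρ χ) (Representation.twist σ χ) where
  toLinearMap := f.toLinearMap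
  isIntertwining' g := by
    rw [Representation.twist_apply, Representation.twist_apply, LinearMap.comp_smul,
      LinearMap.smul_comp, f.isIntertwining' g]

/-- Unfolding lemma for `IntertwiningMap.twist`. [folklore] -/
@[simp] theorem Representation.IntertwiningMap.toLinearMap_twist {ρ : Representation k G V}
    {σ : Representation k G W} (f : Representation.IntertwiningMap ρ σ) (χ : G →* kˣ) :
    (Representation.IntertwiningMap.twist f χ).toLinearMap = f.toLinearMap := rfl

/-- Twisting intertwining maps is a `k`-linear isomorphism
`Hom_G(ρ, σ) ≃ Hom_G(ρ ⊗ χ, σ ⊗ χ)` (inverse: twist by `χ⁻¹`). [folklore] -/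
def Representation.IntertwiningMap.twistLinearEquiv (ρ : Representation k G V)
    (σ : Representation k G W) (χ : G →* kˣ) :
    Representation.IntertwiningMap ρ σ ≃ₗ[k]
      Representation.IntertwiningMap (Representation.twist ρ χ) (Representation.twist σ χ) where
  toFun f := Representation.IntertwiningMap.twist f χ
  invFun f := ⟨f.toLinearMap, fun g => by
    have h := (Representation.IntertwiningMap.twist f χ⁻¹).isIntertwining' g
    simpa only [Representation.twist_twist_inv,
      Representation.IntertwiningMap.toLinearMap_twist] using h⟩
  left_inv f := Representation.IntertwiningMap.ext rfl
  right_inv f := Representation.IntertwiningMap.ext rfl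
  map_add' f g := Representation.IntertwiningMap.ext rfl
  map_smul' c f := Representation.IntertwiningMap.ext rfl

/-- Equivalent representations have equivalent twists. [folklore] -/
def Representation.Equiv.twist {ρ : Representation k G V} {σ : Representation k G W}
    (e : Representation.Equiv ρ σ) (χ : G →* kˣ) :
    Representation.Equiv (Representation.twist ρ χ) (Representation.twist σ χ) :=
  Representation.Equiv.mk e.toLinearEquiv
    (Representation.IntertwiningMap.twist e.toIntertwiningMap χ).isIntertwining'

/-! ### Character and determinant of a twist -/

/-- The character of a twist: `χ_{ρ ⊗ χ}(g) = χ(g) χ_ρ(g)`. [folklore] -/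
theorem Representation.character_twist (ρ : Representation k G V) (χ : G →* kˣ) (g : G) :
    (Representation.twist ρ χ).character g = ((χ g : kˣ) : k) * ρ.character g := by
  simp [Representation.character, Representation.twist_apply]

section Group

variable {Γ : Type v} [Group Γ]

/-- If a finite-dimensional representation `ρ` of a *group* is equivalent to its twist
`ρ ⊗ χ`, then `χ(g)^{dim V} = 1` for every `g` (determinants:
`det ρ(g) = χ(g)^{dim V} det ρ(g)` and `det ρ(g) ≠ 0`). [folklore] -/
theorem Representation.pow_finrank_eq_one_of_equiv_twist [FiniteDimensional k V]
    {ρ : Representation k Γ V} {χ : Γ →* kˣ}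
    (e : Representation.Equiv ρ (Representation.twist ρ χ)) (g : Γ) :
    ((χ g : kˣ) : k) ^ Module.finrank k V = 1 := by
  have h1 : LinearMap.det (Representation.twist ρ χ g) = LinearMap.det (ρ g) := by
    rw [← Representation.Equiv.conj_apply_self g e, LinearEquiv.conj_apply, LinearMap.comp_assoc,
      LinearMap.det_conj]
  rw [Representation.twist_apply, LinearMap.det_smul] at h1
  have h3 : IsUnit (LinearMap.det (ρ g)) :=
    (show IsUnit (ρ g) from ⟨ρ.asGroupHom g, ρ.asGroupHom_apply g⟩).map LinearMap.det
  have h4 : ((χ g : kˣ) : k) ^ Module.finrank k V * LinearMap.det (ρ g) =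
      (1 : k) * LinearMap.det (ρ g) := by rw [one_mul]; exact h1
  exact mul_right_cancel₀ h3.ne_zero h4

/-- **Freeness of twisting.** If `ρ ≠ 0` is finite-dimensional and equivalent to `ρ ⊗ μⁿ` for a
character `μ` taking at some `g₀` a value of infinite order, then `n = 0`. [folklore] -/
theorem Representation.eq_zero_of_equiv_twist_zpow [FiniteDimensional k V] [Nontrivial V]
    {ρ : Representation k Γ V} {μ : Γ →* kˣ} {g₀ : Γ} (hμ : ¬ IsOfFinOrder (μ g₀)) {n : ℤ}
    (e : Representation.Equiv ρ (Representation.twist ρ (μ ^ n))) : n = 0 := by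
  have h := Representation.pow_finrank_eq_one_of_equiv_twist e g₀
  rw [MonoidHom.zpow_apply, ← Units.val_pow_eq_pow_val, Units.val_eq_one, ← zpow_natCast,
    ← zpow_mul] at h
  have hd : (Module.finrank k V : ℤ) ≠ 0 := by exact_mod_cast Module.finrank_pos.ne'
  by_contra hn
  exact hμ (isOfFinOrder_iff_zpow_eq_one.mpr ⟨n * Module.finrank k V, mul_ne_zero hn hd, h⟩)

end Group

end Literature.RepresentationTheory.Semisimple
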